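import Literature.Algebra.Polynomial.BinomialTypeSequences
import Literature.Algebra.Polynomial.UmbralInversePairs
import Mathlib.Tactic
import HarnessLib

/-!
# Cross-sequences (Rota–Kahaner–Odlyzko §8, Theorem 8)

G.-C. Rota, D. Kahaner, A. Odlyzko, *Finite operator calculus* (1973), §8 "Cross-sequences":

> A *cross-sequence* of polynomials, written `p_n^{[λ]} (x)`, where `λ` ranges over the field and
> `n` over the nonnegative integers, is defined by the following properties: (a) for fixed `λ`,
> `p_n^{[λ]} (x)` is a polynomial sequence; (b) for any `λ` and `μ` in the field and any `x` and
> `y`, the identity `p_n^{[λ+μ]} (x + y) = Σ_{k≥0} C(n,k) p_k^{[λ]} (x) p_{n−k}^{[μ]} (y)` (*) holds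
> for all `n`.
> **Theorem 8.** A sequence `p_n^{[λ]} (x)` is a cross-sequence if and only if there exists a
> one-parameter group `P^{−λ}` of shift-invariant operators and a sequence `p_n (x)` of binomial
> type such that `p_n^{[λ]} (x) = P^{−λ} p_n (x)`. (**) (Thus, for fixed `λ` a cross-sequence
> becomes a Sheffer sequence relative to the operator `P^λ`.)
> **Corollary.** If a sequence `p_n^{[λ]}` is a cross-sequence, then there exist delta operators
> `Q` and `R` such that `Q p_n^{[λ]} = n p_{n−1}^{[λ]}`, `R p_n^{[λ+1]} = n p_{n−1}^{[λ]}` (***)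
> ("let `Q` be the delta operator of `p_n (x)`, and let `R = PQ`").
> (p. 715–716) Every invertible shift-invariant operator `P` can be written in the form `P = e^F`
> for some shift-invariant operator (which is never invertible) … Thus `P^{−λ} = exp (−λF)`. …
> We call `F` the *generator* of the cross-sequence. Thus, an operator `F` is the generator of a
> necessarily unique cross-sequence of polynomials, if and only if `F (1) = 0`.
> **Proposition 6.** … (b) If `P` is any invertible operator, then `P^{−λ} p_n^{[λ]} (x)` is a
> cross-sequence when `p_n^{[λ]} (x)` is one.

## Design (what "one-parameter group" means here)

RKO write `P^{−λ}`, `λ ∈ K`, for a *one-parameter group of shift-invariant operators* and, on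
p. 716, identify it with the exponential `exp (−λF)` of a *generator* `F` (`F (1) = 0`). The proof
of Theorem 8 only produces — and only uses — an ABSTRACT group: a family `λ ↦ P^{−λ}` of
shift-invariant operators with `P^{0} = I` and `P^{−λ−μ} = P^{−λ} P^{−μ}`. We therefore type

* `IsOneParameterGroup P` for `P : K → (K[X] →ₗ[K] K[X])` (we write `P a` for RKO's `P^{−a}`,
  so that `p_n^{[a]} = P a (p_n)`): each `P a` is shift-invariant, `P 0 = id`,
  `P (a + b) = P a ∘ P b`;
* `IsCrossSequence p` for `p : K → ℕ → K[X]` (`p a n` is `p_n^{[a]}`): clauses (a), (b) verbatim;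
* the generator form as a definition with body, `expOp F a = (e^{a F})(D)`
  (`= diffOp ((rescale a exp) ∘ F)`), RKO's `P^{−λ} = exp (−λF)` being `expOp F (−λ)`; it IS a
  one-parameter group (`isOneParameterGroup_expOp`).

Theorem 8 is proved for abstract groups in both directions (`IsOneParameterGroup.isCrossSequence`,
`IsCrossSequence.exists_isOneParameterGroup`), exactly along the printed proof. Over a field
`K ≠ ℚ` an abstract one-parameter group need not be of exponential type (`a ↦ τ_{φ(a)}` for an
additive, non-`K`-linear `φ : K → K` gives the cross-sequence `(x + φ(a))ⁿ`), so the statements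
that need the generator (RKO §8 Proposition 1: the coefficients of `p_n^{[λ]}` are polynomials in
`λ`; Proposition 4) are typed for `expOp` in the sequel file on Steffensen sequences, not for
abstract groups — nothing here is stated more strongly than what the printed proofs give.

Main statements: `IsOneParameterGroup.isCrossSequence` (Theorem 8 ⇐),
`IsCrossSequence.isBinomialType_zero`, `IsCrossSequence.isShefferSequence` ("for fixed `λ` a
cross-sequence becomes a Sheffer sequence"), `IsCrossSequence.exists_isOneParameterGroup`
(Theorem 8 ⇒) with uniqueness `IsCrossSequence.isOneParameterGroup_unique`, `isCrossSequence_iff`,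
`IsCrossSequence.exists_isDeltaOperator_pair` (Corollary (***)),
`IsCrossSequence.comp_isOneParameterGroup` (Proposition 6 (b)), the generator form `expOp` with
`isOneParameterGroup_expOp`, `isCrossSequence_expOp_neg` (`exp (−λF) p_n` is a cross-sequence),
`expOp_X` (the translation group `E^a = e^{aD}`, giving the cross-sequence `(x + a)ⁿ`,
`isCrossSequence_X_add_C_pow`) and `expOp_logOf_one` (`P = e^F` with `F = log P` for `P (1) = 1`).
The printed instances (`M_n^{[λ]} = (I − D)^{−λ} xⁿ` of §11, the Hermite polynomials of variance `v`
of §10) and the Steffensen sequences of §8 Propositions 1–5 are typed in sequel files.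

## References
* [RotaKahanerOdlyzko1973] G.-C. Rota, D. Kahaner, A. Odlyzko, *On the foundations of
  combinatorial theory VIII. Finite operator calculus*, J. Math. Anal. Appl. 42 (1973) 684–760,
  §8 pp. 712–716 (Theorem 8, Corollary, Proposition 6, generators).
-/

noncomputable section

open Polynomial Finset

namespace Literature.Algebra.Polynomial

variable {K : Type*} [Field K]

section Definitions

/-- A **one-parameter group of shift-invariant operators** `(P^{−λ})_{λ ∈ K}` (Rota–Kahaner–Odlyzko
§8, Theorem 8): a family `a ↦ P a` (our `P a` is RKO's `P^{−a}`) of shift-invariant operators with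
`P 0 = I` and the group property `P (a + b) = P a P b`.
[cite: RotaKahanerOdlyzko1973, §8 Theorem 8 ("a one-parameter group `P^{−λ}` of shift-invariant
operators … the group property"), p. 712] -/
structure IsOneParameterGroup (P : K → (K[X] →ₗ[K] K[X])) : Prop where
  isShiftInvariant : ∀ a : K, IsShiftInvariant (P a)
  map_zero : P 0 = LinearMap.id
  map_add : ∀ a b : K, P (a + b) = P a ∘ₗ P b

/-- A **cross-sequence** `p_n^{[λ]} (x)` (`p a n` is `p_n^{[a]}`): (a) for fixed `λ`, `(p_n^{[λ]})_n`
is a polynomial sequence (`p_n^{[λ]}` exactly of degree `n`); (b)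
`p_n^{[λ+μ]} (x + y) = Σ_{k=0}^{n} C(n,k) p_k^{[λ]} (x) p_{n−k}^{[μ]} (y)` for all `λ, μ, x, y, n`.
[cite: RotaKahanerOdlyzko1973, §8 (definition of a cross-sequence, (a)–(b)), p. 712] -/
structure IsCrossSequence (p : K → ℕ → K[X]) : Prop where
  degree_eq : ∀ (a : K) (n : ℕ), (p a n).degree = n
  eval_add : ∀ (a b : K) (n : ℕ) (x y : K), (p (a + b) n).eval (x + y) =
    ∑ k ∈ range (n + 1), (n.choose k : K) * (p a k).eval x * (p b (n - k)).eval y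

end Definitions

/-! ## One-parameter groups of shift-invariant operators -/

namespace IsOneParameterGroup

variable {P : K → (K[X] →ₗ[K] K[X])}

/-- `P (a + b) f = P a (P b f)`. [cite: RotaKahanerOdlyzko1973, §8 Theorem 8, p. 712] -/
theorem map_add_apply (hP : IsOneParameterGroup P) (a b : K) (f : K[X]) :
    P (a + b) f = P a (P b f) := by
  rw [hP.map_add, LinearMap.comp_apply]

/-- `P 0 f = f`. [cite: RotaKahanerOdlyzko1973, §8 Theorem 8, p. 712] -/
theorem map_zero_apply (hP : IsOneParameterGroup P) (f : K[X]) : P 0 f = f := by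
  rw [hP.map_zero, LinearMap.id_apply]

/-- The group is commutative: `P a P b = P b P a`.
[cite: RotaKahanerOdlyzko1973, §8 Theorem 8, p. 712] -/
theorem comm (hP : IsOneParameterGroup P) (a b : K) : P a ∘ₗ P b = P b ∘ₗ P a := by
  rw [← hP.map_add, add_comm, hP.map_add]

/-- `P (−a)` is a right inverse of `P a`. [cite: RotaKahanerOdlyzko1973, §8 Theorem 8, p. 712] -/
theorem comp_neg (hP : IsOneParameterGroup P) (a : K) : P a ∘ₗ P (-a) = LinearMap.id := by
  rw [← hP.map_add, add_neg_cancel, hP.map_zero]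

/-- `P (−a)` is a left inverse of `P a`. [cite: RotaKahanerOdlyzko1973, §8 Theorem 8, p. 712] -/
theorem neg_comp (hP : IsOneParameterGroup P) (a : K) : P (-a) ∘ₗ P a = LinearMap.id := by
  rw [← hP.map_add, neg_add_cancel, hP.map_zero]

/-- `P a (P (−a) f) = f`. [cite: RotaKahanerOdlyzko1973, §8 Theorem 8, p. 712] -/
theorem apply_neg_apply (hP : IsOneParameterGroup P) (a : K) (f : K[X]) : P a (P (-a) f) = f := by
  rw [← LinearMap.comp_apply, hP.comp_neg, LinearMap.id_apply]

/-- `P (−a) (P a f) = f`. [cite: RotaKahanerOdlyzko1973, §8 Theorem 8, p. 712] -/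
theorem neg_apply_apply (hP : IsOneParameterGroup P) (a : K) (f : K[X]) : P (-a) (P a f) = f := by
  rw [← LinearMap.comp_apply, hP.neg_comp, LinearMap.id_apply]

/-- Each `P a` is invertible ("one-parameter group"). [cite: RotaKahanerOdlyzko1973, §8 Theorem 8,
p. 712] -/
theorem bijective (hP : IsOneParameterGroup P) (a : K) : Function.Bijective (P a) :=
  ⟨Function.LeftInverse.injective (g := P (-a)) (hP.neg_apply_apply a),
    Function.RightInverse.surjective (g := P (-a)) (hP.apply_neg_apply a)⟩

/-- `P a 1 ≠ 0` (an invertible shift-invariant operator does not kill the constants).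
[cite: RotaKahanerOdlyzko1973, §8 Theorem 8, p. 712] -/
theorem map_one_ne_zero (hP : IsOneParameterGroup P) (a : K) : P a 1 ≠ 0 := fun h =>
  one_ne_zero ((hP.bijective a).1 (h.trans (LinearMap.map_zero (P a)).symm))

/-- The opposite group `a ↦ P (−a)` (RKO's `P^{λ}` versus `P^{−λ}`) is a one-parameter group.
[cite: RotaKahanerOdlyzko1973, §8 Theorem 8, p. 712] -/
theorem neg (hP : IsOneParameterGroup P) : IsOneParameterGroup fun a => P (-a) where
  isShiftInvariant a := hP.isShiftInvariant (-a)
  map_zero := by rw [neg_zero, hP.map_zero]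
  map_add a b := by rw [neg_add, hP.map_add]

/-- The pointwise product of two one-parameter groups is a one-parameter group (shift-invariant
operators commute). [cite: RotaKahanerOdlyzko1973, §8 Proposition 6, p. 716] -/
theorem mul [CharZero K] {P' : K → (K[X] →ₗ[K] K[X])} (hP : IsOneParameterGroup P)
    (hP' : IsOneParameterGroup P') : IsOneParameterGroup fun a => P' a ∘ₗ P a where
  isShiftInvariant a := (hP'.isShiftInvariant a).comp (hP.isShiftInvariant a)
  map_zero := by rw [hP.map_zero, hP'.map_zero, LinearMap.id_comp]
  map_add a b := by
    rw [hP.map_add, hP'.map_add]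
    apply LinearMap.ext
    intro f
    simp only [LinearMap.comp_apply]
    rw [(hP'.isShiftInvariant b).comm_apply (hP.isShiftInvariant a)]

/-- The trivial group `a ↦ I`. [cite: RotaKahanerOdlyzko1973, §8 Theorem 8, p. 712] -/
theorem const_id : IsOneParameterGroup fun _ : K => (LinearMap.id : K[X] →ₗ[K] K[X]) where
  isShiftInvariant _ := IsShiftInvariant.id
  map_zero := rfl
  map_add _ _ := (LinearMap.id_comp _).symm

end IsOneParameterGroup

/-- **The translations `a ↦ E^a` form a one-parameter group** of shift-invariant operators
(`E^a E^b = E^{a+b}`). [cite: RotaKahanerOdlyzko1973, §8 (Theorem 8; the translation operators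
`E^a` of §2), pp. 687, 712] -/
theorem isOneParameterGroup_taylor :
    IsOneParameterGroup fun a : K => (taylor a : K[X] →ₗ[K] K[X]) where
  isShiftInvariant a := isShiftInvariant_taylor a
  map_zero := taylor_zero'
  map_add a b := by
    apply LinearMap.ext
    intro f
    rw [LinearMap.comp_apply, taylor_taylor, add_comm]

/-! ## Theorem 8, first half: `P^{−λ} p_n` is a cross-sequence -/

section ToCross

variable [CharZero K]

/-- The binomial identity (S) of a Sheffer set as an identity of polynomials in `x` with parameter
`y`: `τ_y s_n = Σ_k C(n,k) s_{n−k} (y) · p_k`. [cite: RotaKahanerOdlyzko1973, §5 Proposition 6,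
p. 703] -/
theorem IsShefferSequence.taylor_apply_eq_sum {δ : K[X] →ₗ[K] K[X]} {p s : ℕ → K[X]}
    (hδ : IsDeltaOperator δ) (hp : IsBasicSequence δ p) (hs : IsShefferSequence δ s) (y : K) (n : ℕ) :
    taylor y (s n) = ∑ k ∈ range (n + 1), ((n.choose k : K) * (s (n - k)).eval y) • p k := by
  apply Polynomial.funext
  intro x
  rw [taylor_eval, hs.eval_add hδ hp n x y, eval_finsetSum]
  exact sum_congr rfl fun k _ => by rw [eval_smul, smul_eq_mul]; ring

namespace IsOneParameterGroup

variable {P : K → (K[X] →ₗ[K] K[X])} {q : ℕ → K[X]}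

/-- For a one-parameter group `P` and a sequence `q_n` of binomial type, `P a q_n` is a Sheffer set
for the delta operator of `q_n` ("for fixed `λ` a cross-sequence becomes a Sheffer sequence
relative to the operator `P^λ`"). [cite: RotaKahanerOdlyzko1973, §8 Theorem 8, p. 712] -/
theorem isShefferSequence_map (hP : IsOneParameterGroup P) (hq : IsBinomialType q) (a : K) :
    IsShefferSequence (loweringOperator hq.degree_eq) fun n => P a (q n) :=
  hq.isBasicSequence.isShefferSequence_map hq.isDeltaOperator_loweringOperator (hP.isShiftInvariant a)
    (hP.map_one_ne_zero a)

/-- **Theorem 8, "every sequence defined by the right side of (**) is a cross-sequence"**: for a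
one-parameter group `P^{−λ}` of shift-invariant operators and `p_n` of binomial type,
`p_n^{[λ]} = P^{−λ} p_n` is a cross-sequence (apply `P^{−λ}` to the binomial identity, permute `x`
and `y`, apply `P^{−μ}`). [cite: RotaKahanerOdlyzko1973, §8 Theorem 8 (proof, first part), p. 712] -/
theorem isCrossSequence (hP : IsOneParameterGroup P) (hq : IsBinomialType q) :
    IsCrossSequence fun a n => P a (q n) where
  degree_eq a n := (hP.isShefferSequence_map hq a).degree_eq n
  eval_add a b n x y := by
    have hδ := hq.isDeltaOperator_loweringOperator
    -- (S) for the Sheffer set `P b q` as a polynomial identity in `x`, then apply `P a`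
    have h := congrArg (P a) ((hP.isShefferSequence_map hq b).taylor_apply_eq_sum hδ hq.isBasicSequence y n)
    rw [(hP.isShiftInvariant a).apply_taylor, map_sum] at h
    have h' := congrArg (eval x) h
    rw [taylor_eval, ← hP.map_add_apply, eval_finsetSum] at h'
    rw [h']
    exact sum_congr rfl fun k _ => by rw [map_smul, eval_smul, smul_eq_mul]; ring

end IsOneParameterGroup

/-- **The translates `(x + a)ⁿ = E^a xⁿ` form a cross-sequence** (the simplest instance of Theorem 8:
`P^{−λ} = E^λ`, `p_n = xⁿ`). [cite: RotaKahanerOdlyzko1973, §8 Theorem 8, p. 712] -/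
theorem isCrossSequence_X_add_C_pow : IsCrossSequence fun (a : K) (n : ℕ) => (X + C a) ^ n := by
  have h := isOneParameterGroup_taylor.isCrossSequence (isBinomialType_X_pow (K := K))
  simp only [taylor_pow, taylor_X] at h
  exact h

end ToCross

/-! ## Theorem 8, second half: every cross-sequence is `P^{−λ} p_n` -/

namespace IsCrossSequence

variable {p : K → ℕ → K[X]}

/-- `deg p_n^{[a]} = n` as a `natDegree`. [cite: RotaKahanerOdlyzko1973, §8 (a), p. 712] -/
theorem natDegree_eq (hp : IsCrossSequence p) (a : K) (n : ℕ) : (p a n).natDegree = n :=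
  natDegree_eq_of_degree_eq_some (hp.degree_eq a n)

/-- **"The sequence `p_n (x) = p_n^{[0]} (x)` is of binomial type"** (set `λ = μ = 0` in (*)).
[cite: RotaKahanerOdlyzko1973, §8 Theorem 8 (proof of the converse), p. 712] -/
theorem isBinomialType_zero (hp : IsCrossSequence p) : IsBinomialType (p 0) where
  degree_eq := hp.degree_eq 0
  eval_add n x y := by
    have h := hp.eval_add 0 0 n x y
    rwa [add_zero] at h

variable [CharZero K]

/-- **For fixed `λ`, `p_n^{[λ]}` is a Sheffer set relative to the delta operator of `p_n^{[0]}`**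
("setting `μ = 0` in (*) and applying Proposition 3 of Section 5" — here §5 Proposition 6).
[cite: RotaKahanerOdlyzko1973, §8 Theorem 8 (proof of the converse), pp. 712–713] -/
theorem isShefferSequence (hp : IsCrossSequence p) (a : K) :
    IsShefferSequence (loweringOperator hp.isBinomialType_zero.degree_eq) (p a) := by
  refine (isShefferSequence_iff_eval_add hp.isBinomialType_zero.isDeltaOperator_loweringOperator
    hp.isBinomialType_zero.isBasicSequence).2 ⟨hp.degree_eq a, fun n x y => ?_⟩
  have h := hp.eval_add 0 a n x y
  rwa [zero_add] at h

/-- (*) at `x = 0` as a polynomial identity: `p_n^{[a+b]} = Σ_k C(n,k) p_{n−k}^{[b]} (0) · p_k^{[a]}`.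
[cite: RotaKahanerOdlyzko1973, §8 Theorem 8 (proof of the converse), p. 713] -/
theorem apply_add_eq_sum (hp : IsCrossSequence p) (a b : K) (n : ℕ) :
    p (a + b) n = ∑ k ∈ range (n + 1), ((n.choose k : K) * (p b (n - k)).eval 0) • p a k := by
  apply Polynomial.funext
  intro x
  rw [← add_zero x, hp.eval_add a b n x 0, add_zero, eval_finsetSum]
  exact sum_congr rfl fun k _ => by rw [eval_smul, smul_eq_mul]; ring

/-- A linear operator carrying `p_n^{[0]}` to `p_n^{[a]}` carries `p_n^{[b]}` to `p_n^{[a+b]}`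
("applying `P^{−μ}` to both sides … the right side equals `P^{−λ−μ} p_n (x + y)` again by (*)").
[cite: RotaKahanerOdlyzko1973, §8 Theorem 8 (proof of the converse), p. 713] -/
theorem map_apply_of_map_zero (hp : IsCrossSequence p) {T : K[X] →ₗ[K] K[X]} {a : K}
    (hT : ∀ n, T (p 0 n) = p a n) (b : K) (n : ℕ) : T (p b n) = p (a + b) n := by
  have h0 := hp.apply_add_eq_sum 0 b n
  rw [zero_add] at h0
  rw [h0, map_sum, hp.apply_add_eq_sum a b n]
  exact sum_congr rfl fun k _ => by rw [map_smul, hT]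

/-- **Theorem 8, converse**: every cross-sequence is `p_n^{[λ]} = P^{−λ} p_n` for a (unique)
one-parameter group `P^{−λ}` of shift-invariant operators and the binomial-type sequence
`p_n = p_n^{[0]}` (`P^{−λ}` is the operator `p_n ↦ p_n^{[λ]}`; the group property is read off (*)).
[cite: RotaKahanerOdlyzko1973, §8 Theorem 8, pp. 712–713] -/
theorem exists_isOneParameterGroup (hp : IsCrossSequence p) :
    ∃ P : K → (K[X] →ₗ[K] K[X]), IsOneParameterGroup P ∧ IsBinomialType (p 0) ∧
      ∀ (a : K) (n : ℕ), p a n = P a (p 0 n) := by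
  have hq := hp.isBinomialType_zero
  have hδ := hq.isDeltaOperator_loweringOperator
  have hqb := hq.isBasicSequence
  choose P hPsi _ hPp using fun a => (hp.isShefferSequence a).exists_isShiftInvariant hδ hqb
  refine ⟨P, ⟨hPsi, ?_, fun a b => ?_⟩, hq, fun a n => (hPp a n).symm⟩
  · exact hqb.linearMap_ext fun n => by rw [hPp, LinearMap.id_apply]
  · exact hqb.linearMap_ext fun n => by
      rw [hPp, LinearMap.comp_apply, hPp, hp.map_apply_of_map_zero (hPp a) b n]

omit [CharZero K] in
/-- **Uniqueness of the group in Theorem 8**: a one-parameter group (indeed any family of linear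
operators) with `P^{−λ} p_n^{[0]} = p_n^{[λ]}` is determined by the cross-sequence.
[cite: RotaKahanerOdlyzko1973, §8 Theorem 8, pp. 712–713] -/
theorem isOneParameterGroup_unique (hp : IsCrossSequence p) {P P' : K → (K[X] →ₗ[K] K[X])}
    (hP : ∀ a n, P a (p 0 n) = p a n) (hP' : ∀ a n, P' a (p 0 n) = p a n) : P = P' :=
  funext fun a => hp.isBinomialType_zero.isBasicSequence.linearMap_ext fun n => by rw [hP, hP']

/-- **Theorem 8, both halves**: `p` is a cross-sequence iff `p_n^{[λ]} = P^{−λ} q_n` for a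
one-parameter group of shift-invariant operators and a sequence `q_n` of binomial type.
[cite: RotaKahanerOdlyzko1973, §8 Theorem 8, p. 712] -/
theorem _root_.Literature.Algebra.Polynomial.isCrossSequence_iff {p : K → ℕ → K[X]} :
    IsCrossSequence p ↔ ∃ (P : K → (K[X] →ₗ[K] K[X])) (q : ℕ → K[X]),
      IsOneParameterGroup P ∧ IsBinomialType q ∧ ∀ a n, p a n = P a (q n) := by
  constructor
  · intro hp
    obtain ⟨P, hP, hq, h⟩ := hp.exists_isOneParameterGroup
    exact ⟨P, p 0, hP, hq, h⟩
  · rintro ⟨P, q, hP, hq, h⟩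
    have h' : p = fun a n => P a (q n) := funext fun a => funext fun n => h a n
    rw [h']
    exact hP.isCrossSequence hq

/-! ## The Corollary: the delta operators `Q` and `R = PQ` -/

/-- A delta operator followed by an invertible shift-invariant operator is a delta operator
(`R = PQ`). [cite: RotaKahanerOdlyzko1973, §8 Corollary to Theorem 8 ("let `R = PQ`"), p. 713] -/
theorem _root_.Literature.Algebra.Polynomial.IsDeltaOperator.isShiftInvariant_comp
    {δ S : K[X] →ₗ[K] K[X]} (hδ : IsDeltaOperator δ) (hS : IsShiftInvariant S) (hS1 : S 1 ≠ 0) :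
    IsDeltaOperator (S ∘ₗ δ) := by
  obtain ⟨c, hc, hX⟩ := hδ.exists_map_X
  have hS1' : S 1 = C ((S 1).eval 0) := hS.map_one_eq_C
  have h1 : (S 1).eval 0 ≠ 0 := fun h => hS1 (by rw [hS1', h, C_0])
  refine ⟨hS.comp hδ.isShiftInvariant, c * (S 1).eval 0, mul_ne_zero hc h1, ?_⟩
  rw [LinearMap.comp_apply, hX, ← mul_one (C c), ← smul_eq_C_mul, map_smul, smul_eq_C_mul]
  conv_lhs => rw [hS1']
  rw [← C_mul]

/-- **Corollary (***)**: for a cross-sequence there are delta operators `Q` (the delta operator of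
`p_n = p_n^{[0]}`) and `R = PQ` (`P = P^{1}`) with `Q p_n^{[λ]} = n p_{n−1}^{[λ]}` and
`R p_n^{[λ+1]} = n p_{n−1}^{[λ]}` for all `λ` and `n ≥ 1`.
[cite: RotaKahanerOdlyzko1973, §8 Corollary to Theorem 8, p. 713] -/
theorem exists_isDeltaOperator_pair (hp : IsCrossSequence p) :
    ∃ Q R : K[X] →ₗ[K] K[X], IsDeltaOperator Q ∧ IsDeltaOperator R ∧
      (∀ (a : K) (n : ℕ), Q (p a (n + 1)) = ((n + 1 : ℕ) : K) • p a n) ∧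
      ∀ (a : K) (n : ℕ), R (p (a + 1) (n + 1)) = ((n + 1 : ℕ) : K) • p a n := by
  obtain ⟨P, hP, hq, h⟩ := hp.exists_isOneParameterGroup
  set Q := loweringOperator hq.degree_eq
  have hδ : IsDeltaOperator Q := hq.isDeltaOperator_loweringOperator
  refine ⟨Q, P (-1) ∘ₗ Q, hδ, hδ.isShiftInvariant_comp (hP.isShiftInvariant (-1)) (hP.map_one_ne_zero (-1)),
    fun a n => ?_, fun a n => ?_⟩
  · rw [h a (n + 1), hδ.isShiftInvariant.comm_apply (hP.isShiftInvariant a),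
      loweringOperator_apply_succ, map_smul, ← h a n]
  · rw [LinearMap.comp_apply, h (a + 1) (n + 1),
      hδ.isShiftInvariant.comm_apply (hP.isShiftInvariant (a + 1)), loweringOperator_apply_succ,
      map_smul, map_smul, ← hP.map_add_apply, show -1 + (a + 1) = a by ring, ← h a n]

/-! ## Proposition 6 (b): twisting a cross-sequence by a second group -/

/-- **Proposition 6 (b)**: if `P'^{−λ}` is a one-parameter group of (invertible) shift-invariant
operators, then `P'^{−λ} p_n^{[λ]}` is a cross-sequence when `p_n^{[λ]}` is one.
[cite: RotaKahanerOdlyzko1973, §8 Proposition 6 (b), p. 716] -/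
theorem comp_isOneParameterGroup (hp : IsCrossSequence p) {P' : K → (K[X] →ₗ[K] K[X])}
    (hP' : IsOneParameterGroup P') : IsCrossSequence fun a n => P' a (p a n) := by
  obtain ⟨P, hP, hq, h⟩ := hp.exists_isOneParameterGroup
  have h' : (fun a n => P' a (p a n)) = fun a n => (P' a ∘ₗ P a) (p 0 n) :=
    funext fun a => funext fun n => by rw [LinearMap.comp_apply, ← h]
  rw [h']
  exact (hP.mul hP').isCrossSequence hq

end IsCrossSequence

/-! ## Generators: the exponential one-parameter group `exp (aF)` -/

section Generator

variable [CharZero K]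

/-- **The exponential group of a generator**: `expOp F a = e^{aF(D)} = (e^{at} ∘ F)(D)` for a
series `F` without constant term ("`P^{−λ} = exp (−λF)` … we call `F` the generator of the
cross-sequence"; RKO's `P^{−λ}` is `expOp F (−λ)`).
[cite: RotaKahanerOdlyzko1973, §8 (generators), pp. 715–716] -/
def expOp (F : PowerSeries K) (a : K) : K[X] →ₗ[K] K[X] :=
  diffOp ((PowerSeries.rescale a (PowerSeries.exp K)).subst F)

/-- Unfolding. [cite: RotaKahanerOdlyzko1973, §8 (generators), p. 716] -/
theorem expOp_eq (F : PowerSeries K) (a : K) :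
    expOp F a = diffOp ((PowerSeries.rescale a (PowerSeries.exp K)).subst F) :=
  rfl

/-- `exp (aF)` is shift-invariant. [cite: RotaKahanerOdlyzko1973, §8 (generators), p. 716] -/
theorem isShiftInvariant_expOp (F : PowerSeries K) (a : K) : IsShiftInvariant (expOp F a) :=
  isShiftInvariant_diffOp _

variable {F : PowerSeries K}

/-- `e^{0·t} ∘ F = 1`. [cite: RotaKahanerOdlyzko1973, §8 (generators), p. 716] -/
theorem rescale_zero_exp_subst (F : PowerSeries K) :
    ((PowerSeries.rescale (0 : K) (PowerSeries.exp K)).subst F : PowerSeries K) = 1 := by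
  rw [PowerSeries.rescale_zero, RingHom.comp_apply, PowerSeries.constantCoeff_exp, PowerSeries.subst_C]
  exact map_one _

/-- **The group law `e^{aF} e^{bF} = e^{(a+b)F}`** (`e^{at} e^{bt} = e^{(a+b)t}` composed with `F`).
[cite: RotaKahanerOdlyzko1973, §8 (generators: "`P^{−λ} = exp (−λF)`"), p. 716] -/
theorem rescale_exp_subst_mul (hF : PowerSeries.constantCoeff F = 0) (a b : K) :
    ((PowerSeries.rescale a (PowerSeries.exp K)).subst F : PowerSeries K) *
        (PowerSeries.rescale b (PowerSeries.exp K)).subst F =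
      (PowerSeries.rescale (a + b) (PowerSeries.exp K)).subst F := by
  rw [← PowerSeries.subst_mul (PowerSeries.HasSubst.of_constantCoeff_zero' hF),
    PowerSeries.exp_mul_exp_eq_exp_add]

/-- **`a ↦ exp (aF)` is a one-parameter group of shift-invariant operators** (`F (1) = 0`, i.e.
`F` without constant term). [cite: RotaKahanerOdlyzko1973, §8 (generators), pp. 715–716] -/
theorem isOneParameterGroup_expOp (hF : PowerSeries.constantCoeff F = 0) :
    IsOneParameterGroup (expOp F) where
  isShiftInvariant := isShiftInvariant_expOp F
  map_zero := by rw [expOp_eq, rescale_zero_exp_subst F, diffOp_one]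
  map_add a b := by rw [expOp_eq, expOp_eq, expOp_eq, ← diffOp_mul, rescale_exp_subst_mul hF]

/-- `(e^{at} ∘ F)(0) = 1`. [cite: RotaKahanerOdlyzko1973, §8 (generators), p. 716] -/
theorem constantCoeff_rescale_exp_subst (hF : PowerSeries.constantCoeff F = 0) (a : K) :
    PowerSeries.constantCoeff ((PowerSeries.rescale a (PowerSeries.exp K)).subst F : PowerSeries K) = 1 := by
  rw [powerSeries_constantCoeff_subst hF, ← PowerSeries.coeff_zero_eq_constantCoeff_apply,
    PowerSeries.coeff_rescale, pow_zero, one_mul, PowerSeries.coeff_zero_eq_constantCoeff_apply,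
    PowerSeries.constantCoeff_exp]

/-- `exp (aF) (1) = 1`: the operators of an exponential group fix the constants.
[cite: RotaKahanerOdlyzko1973, §8 (generators), p. 716] -/
theorem expOp_apply_one (hF : PowerSeries.constantCoeff F = 0) (a : K) : expOp F a 1 = 1 := by
  rw [expOp_eq, diffOp_apply_one, constantCoeff_rescale_exp_subst hF, C_1]

/-- `exp (aF) exp (bF) = exp ((a + b) F)` as operators.
[cite: RotaKahanerOdlyzko1973, §8 (generators), p. 716] -/
theorem expOp_add (hF : PowerSeries.constantCoeff F = 0) (a b : K) :
    expOp F (a + b) = expOp F a ∘ₗ expOp F b :=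
  (isOneParameterGroup_expOp hF).map_add a b

/-- `exp (0·F) = I`. [cite: RotaKahanerOdlyzko1973, §8 (generators), p. 716] -/
theorem expOp_zero (F : PowerSeries K) : expOp F 0 = LinearMap.id := by
  rw [expOp_eq, rescale_zero_exp_subst F, diffOp_one]

/-- **The cross-sequence generated by `F`**: `p_n^{[λ]} = exp (−λF) p_n` is a cross-sequence for every
sequence `p_n` of binomial type ("an operator `F` is the generator of a … cross-sequence of polynomials
if and only if `F (1) = 0`"). [cite: RotaKahanerOdlyzko1973, §8 (generators), p. 716] -/
theorem isCrossSequence_expOp_neg (hF : PowerSeries.constantCoeff F = 0) {q : ℕ → K[X]}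
    (hq : IsBinomialType q) : IsCrossSequence fun a n => expOp F (-a) (q n) :=
  (isOneParameterGroup_expOp hF).neg.isCrossSequence hq

/-- The same with the opposite sign convention `p_n^{[λ]} = exp (λF) p_n`.
[cite: RotaKahanerOdlyzko1973, §8 (generators), p. 716] -/
theorem isCrossSequence_expOp (hF : PowerSeries.constantCoeff F = 0) {q : ℕ → K[X]}
    (hq : IsBinomialType q) : IsCrossSequence fun a n => expOp F a (q n) :=
  (isOneParameterGroup_expOp hF).isCrossSequence hq

/-- **The translation group is exponential with generator `D`**: `E^a = e^{aD}`, i.e.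
`expOp t a = τ_a`. [cite: RotaKahanerOdlyzko1973, §8 (generators; `E^a = e^{aD}` of §3), pp. 692, 716] -/
theorem expOp_X (a : K) : expOp (PowerSeries.X : PowerSeries K) a = taylor a := by
  rw [expOp_eq, PowerSeries.X_subst, taylor_eq_diffOp_exp]

/-- **"Every invertible shift-invariant operator `P` can be written in the form `P = e^F`"**: for
`P = φ(D)` with `φ (0) = 1` ("`P = I + S` where `S 1 = 0`"), `F = log (I + S)` is the series
`logOf φ = log (1 + (φ − 1))` and `e^{F} = P`, i.e. `expOp (logOf φ) 1 = φ(D)`.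
[cite: RotaKahanerOdlyzko1973, §8 (generators), pp. 715–716] -/
theorem expOp_logOf_one {φ : PowerSeries K} (hφ : PowerSeries.constantCoeff φ = 1) :
    expOp (PowerSeries.logOf φ) 1 = diffOp φ := by
  have hφ1 : PowerSeries.constantCoeff (φ - 1) = 0 := by rw [map_sub, hφ, map_one, sub_self]
  have hs : PowerSeries.HasSubst (φ - 1) := PowerSeries.HasSubst.of_constantCoeff_zero' hφ1
  rw [expOp_eq, PowerSeries.rescale_one, RingHom.id_apply, PowerSeries.logOf_eq,
    ← PowerSeries.subst_comp_subst_apply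
      (PowerSeries.HasSubst.of_constantCoeff_zero' PowerSeries.constantCoeff_log) hs,
    exp_subst_log, PowerSeries.subst_add hs, powerSeries_one_subst hφ1,
    PowerSeries.subst_X hs, add_sub_cancel]

/-- The generator `log P` has no constant term (`F (1) = 0`).
[cite: RotaKahanerOdlyzko1973, §8 (generators), p. 716] -/
theorem constantCoeff_logOf_eq_zero {φ : PowerSeries K} (hφ : PowerSeries.constantCoeff φ = 1) :
    PowerSeries.constantCoeff (PowerSeries.logOf φ) = 0 :=
  PowerSeries.constantCoeff_logOf hφ

/-- Hence the powers `P^{a} := e^{a log P}` of an invertible shift-invariant `P = φ(D)`, `φ (0) = 1`,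
form a one-parameter group through `P` ("Thus `P^{−λ} = exp (−λF)`").
[cite: RotaKahanerOdlyzko1973, §8 (generators), p. 716] -/
theorem isOneParameterGroup_expOp_logOf {φ : PowerSeries K} (hφ : PowerSeries.constantCoeff φ = 1) :
    IsOneParameterGroup (expOp (PowerSeries.logOf φ)) ∧ expOp (PowerSeries.logOf φ) 1 = diffOp φ :=
  ⟨isOneParameterGroup_expOp (PowerSeries.constantCoeff_logOf hφ), expOp_logOf_one hφ⟩

end Generator

end Literature.Algebra.Polynomial
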